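import Literature.NumberTheory.Automorphic.GodementJacquetGlobalConvergence
import Literature.NumberTheory.Automorphic.GLnZetaKernel
import Literature.NumberTheory.Automorphic.AutomorphicKernelL1
import Literature.NumberTheory.Automorphic.AutomorphicQuotientKernelNoncompact
import HarnessLib

/-!
# The truncated global zeta integral `Z^{<1}(Φ, s, φ, φ')` of Godement–Jacquet and its unfolding
# over the automorphic quotient

Topic `NumberTheory/Automorphic`; namespace `Literature.NumberTheory.Automorphic`. A brick of the
discharge of `GodementJacquet1972_gjZeta_meromorphic` (Godement–Jacquet, LNM 260 (1972), §12–13: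
`Z(Φ, s, f) = ∫_{|det| ≥ 1} + ∫_{|det| < 1}`, and the second integral is unfolded over
`GL_n(K) A_G \ GL_n(𝔸)` before Poisson summation). For the global zeta integral `gjZeta` of
`GodementJacquetZetaIntegrals`, the truncation at `|det| = 1` of `GodementJacquetGlobalHolomorphy`
(`detAtLeastOne`, `gjZeta_eq_restrict_add_restrict_compl`) and the kernel machinery
`AutomorphicKernelL1` / `GLnZetaKernel`:

* `gjTruncF n K Φ s g = Φ(g) |det g|_𝔸^s 𝟙_{|det g| < 1}` — the truncated test function on `GL_n(𝔸_K)`;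
  `norm_gjTruncF_le`, `integrable_gjTruncF` (**`F_s^< ∈ L¹` for `Re s ≥ n² + n + 2`**, by
  `GodementJacquetGlobalConvergence`), `integral_gjTruncF_mul_glMatrixCoeff`
  (**`∫ F_s^< ⟪φ', R φ⟫ dν = Z^{<1} = gjZeta μ (ν|_{|det|<1}) Φ φ φ' s`**);
* `glMatrixCoeff_eq_integral` — `⟪φ', R(g) φ⟫ = ∫_X conj(φ'(x)) φ(g⁻¹ • x) dμ(x)`;
* `ae_integrable_comp_mul_inv_mul_inv` (general closed subgroup `H ≤ G`) — for `F ∈ L¹(G)` strongly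
  measurable and each `x̃`, `h ↦ F(x̃ h⁻¹ ỹ⁻¹)` is `ρ`-integrable for a.e. `ỹH` (Weil's formula);
  `ae_integrable_gjTruncF_fiber` — its instance for `F_s^<` and `H = A_G · GL_n(K)`;
* `gjZeta_restrict_compl_eq_inv_mul_integral_cosetKernel` — **the unfolding**
  `Z^{<1}(Φ, s, φ, φ') = c⁻¹ ∫_X conj(φ'(x)) ∫_X K_{F_s^<}(x̃, y) φ(y) dμ(y) dμ(x)`,
  `c` the unfolding constant of `ρ_H = quotientSubgroupHaar`, `K` the kernel `cosetKernel`, valid for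
  all `φ, φ' ∈ L²(X)`, any automorphic measure `μ` and Haar measure `ν`, `Re s ≥ n² + n + 2`.

Everything is proved. Local instances: the house set `adelicBorel`, … of the `GL_n` line, the tree's
Borel structure on the quotient keyed on `G ⧸ H` (`measurableSpaceQuotient`), and `glBorel` — the same
`adelicBorel n K` keyed on the syntactic form `GL (Fin n) (AdeleRing (𝓞 K) K)` — with the bridge
`isHaarMeasure_glForm`, so that the `GL (Fin n) 𝔸`-typed objects of `GodementJacquetZetaIntegrals`
elaborate against measures on `(AdelicGroupData.gl n K).Adelic`.

## References

* R. Godement, H. Jacquet, *Zeta functions of simple algebras*, LNM 260 (1972), §12–13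
  [GodementJacquet1972].
* H. Jacquet, *Principal L-functions of the linear group*, Proc. Sympos. Pure Math. 33.2 (1979), §4
  [folklore].
-/

noncomputable section

open MeasureTheory Measure Set Filter Topology IsDedekindDomain NumberField
open Literature.MeasureTheory.Group
open scoped ENNReal NNReal ComplexConjugate MatrixGroups

namespace Literature.NumberTheory.Automorphic

-- the quotient carries the tree's Borel σ-algebra, not Mathlib's quotient σ-algebra
attribute [-instance] Quotient.instMeasurableSpace QuotientGroup.measurableSpace

section Truncated

variable (n : ℕ) (K : Type) [Field K] [NumberField K]

attribute [local instance] adelicBorel borelSpace_adelic locallyCompactSpace_adelic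
  secondCountableTopology_gl_adelic measurableSpaceQuotient borelSpaceQuotient

/-- The house Borel σ-algebra `adelicBorel n K`, keyed on the syntactic form
`GL (Fin n) (AdeleRing (𝓞 K) K)` of the carrier (it *is* `adelicBorel n K`, not merely equal to it;
a *local* instance, so that the objects of `GodementJacquetZetaIntegrals`, whose measurable structure is
an instance argument on this form, elaborate against measures on `(AdelicGroupData.gl n K).Adelic`).
[folklore] -/
@[reducible] def glBorel : MeasurableSpace (GL (Fin n) (AdeleRing (𝓞 K) K)) := adelicBorel n K

attribute [local instance] glBorel

/-- `GL_n(𝔸_K)` with `glBorel` is a Borel space. [folklore] -/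
theorem borelSpace_glBorel : @BorelSpace (GL (Fin n) (AdeleRing (𝓞 K) K)) _ (glBorel n K) := ⟨rfl⟩

attribute [local instance] borelSpace_glBorel

/-- A Haar measure on `(AdelicGroupData.gl n K).Adelic` is a Haar measure on the syntactic form
`GL (Fin n) (AdeleRing (𝓞 K) K)` (the same statement; a bridge for instance resolution, local
instance). [folklore] -/
theorem isHaarMeasure_glForm (ν : Measure (AdelicGroupData.gl n K).Adelic) [h : ν.IsHaarMeasure] :
    @Measure.IsHaarMeasure (GL (Fin n) (AdeleRing (𝓞 K) K)) _ _ (glBorel n K) ν := h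

attribute [local instance] isHaarMeasure_glForm

/-- **The truncated test function** `F_s^<(g) = Φ(g) |det g|_𝔸^s 𝟙_{|det g|_𝔸 < 1}` on `GL_n(𝔸_K)`
(Godement–Jacquet (1972), §12–13: the splitting of `Z(Φ, s, f)` at `|det| = 1`). [folklore] -/
def gjTruncF (Φ : Matrix (Fin n) (Fin n) (AdeleRing (𝓞 K) K) → ℂ) (s : ℂ)
    (g : GL (Fin n) (AdeleRing (𝓞 K) K)) : ℂ :=
  (detAtLeastOne n K)ᶜ.indicator
    (fun g => Φ (g : Matrix (Fin n) (Fin n) (AdeleRing (𝓞 K) K)) * ((adelicAbsDet n K g : ℝ) : ℂ) ^ s) g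

variable {n K}

/-- Unfolding of `gjTruncF`. [folklore] -/
theorem gjTruncF_apply (Φ : Matrix (Fin n) (Fin n) (AdeleRing (𝓞 K) K) → ℂ) (s : ℂ)
    (g : GL (Fin n) (AdeleRing (𝓞 K) K)) :
    gjTruncF n K Φ s g = (detAtLeastOne n K)ᶜ.indicator
      (fun g => Φ (g : Matrix (Fin n) (Fin n) (AdeleRing (𝓞 K) K)) * ((adelicAbsDet n K g : ℝ) : ℂ) ^ s) g := rfl

/-- `|F_s^<(g)| ≤ |Φ(g)| |det g|_𝔸^{Re s}`. [folklore] -/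
theorem norm_gjTruncF_le (Φ : Matrix (Fin n) (Fin n) (AdeleRing (𝓞 K) K) → ℂ) (s : ℂ)
    (g : GL (Fin n) (AdeleRing (𝓞 K) K)) :
    ‖gjTruncF n K Φ s g‖ ≤ ‖Φ (g : Matrix (Fin n) (Fin n) (AdeleRing (𝓞 K) K))‖ * (adelicAbsDet n K g : ℝ) ^ s.re := by
  rw [gjTruncF_apply]
  by_cases hg : g ∈ (detAtLeastOne n K)ᶜ
  · rw [Set.indicator_of_mem hg, norm_mul, Complex.norm_cpow_eq_rpow_re_of_pos (adelicAbsDet_pos g)]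
  · rw [Set.indicator_of_notMem hg, norm_zero]
    positivity

/-- `F_s^<` is a.e. strongly measurable (indicator of the open set `{|det| < 1}` times a continuous
function). [folklore] -/
theorem aestronglyMeasurable_gjTruncF {Φ : Matrix (Fin n) (Fin n) (AdeleRing (𝓞 K) K) → ℂ}
    (hΦ : Φ ∈ schwartzBruhatAdelicMatrix n K) (s : ℂ) (ν : Measure (AdelicGroupData.gl n K).Adelic) :
    AEStronglyMeasurable (gjTruncF n K Φ s) ν := by
  have hc : Continuous fun g : GL (Fin n) (AdeleRing (𝓞 K) K) =>
      Φ (g : Matrix (Fin n) (Fin n) (AdeleRing (𝓞 K) K)) * ((adelicAbsDet n K g : ℝ) : ℂ) ^ s :=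
    ((continuous_of_mem_schwartzBruhatAdelicMatrix hΦ).comp Units.continuous_val).mul
      (continuous_adelicAbsDet_cpow s)
  exact (hc.aestronglyMeasurable).indicator (measurableSet_detAtLeastOne (n := n) (K := K)).compl

/-- **`F_s^< ∈ L¹(GL_n(𝔸_K))` for `Re s ≥ n² + n + 2`** (`|F_s^<| ≤ |Φ| |det|^{Re s}`, integrable by
`integrable_norm_mul_adelicAbsDet_rpow_of_mem_schwartzBruhat` of `GodementJacquetGlobalConvergence`).
[folklore] -/
theorem integrable_gjTruncF {Φ : Matrix (Fin n) (Fin n) (AdeleRing (𝓞 K) K) → ℂ}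
    (hΦ : Φ ∈ schwartzBruhatAdelicMatrix n K) {s : ℂ} (hs : (n : ℝ) * n + n + 2 ≤ s.re)
    (ν : Measure (AdelicGroupData.gl n K).Adelic) [ν.IsHaarMeasure] :
    Integrable (gjTruncF n K Φ s) ν :=
  (integrable_norm_mul_adelicAbsDet_rpow_of_mem_schwartzBruhat
      (ν : Measure (GL (Fin n) (AdeleRing (𝓞 K) K))) hΦ hs).mono'
    (aestronglyMeasurable_gjTruncF hΦ s ν) (Eventually.of_forall (norm_gjTruncF_le Φ s))

variable (μ : Measure (AdelicGroupData.gl n K).automorphicQuotient)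
  [(AdelicGroupData.gl n K).IsAutomorphicMeasure μ]

/-- Pointwise: `F_s^<(g) ⟪φ', R(g) φ⟫ = 𝟙_{|det g| < 1} · (Φ(g) ⟪φ', R(g) φ⟫ |det g|^s)`. [folklore] -/
theorem gjTruncF_mul_glMatrixCoeff_eq_indicator (Φ : Matrix (Fin n) (Fin n) (AdeleRing (𝓞 K) K) → ℂ)
    (φ φ' : (AdelicGroupData.gl n K).L2 μ) (s : ℂ) (g : GL (Fin n) (AdeleRing (𝓞 K) K)) :
    gjTruncF n K Φ s g * glMatrixCoeff μ φ φ' g =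
      (detAtLeastOne n K)ᶜ.indicator (gjZetaIntegrand μ Φ φ φ' s) g := by
  rw [gjTruncF_apply]
  by_cases hg : g ∈ (detAtLeastOne n K)ᶜ
  · rw [Set.indicator_of_mem hg, Set.indicator_of_mem hg, gjZetaIntegrand]
    ring
  · rw [Set.indicator_of_notMem hg, Set.indicator_of_notMem hg, zero_mul]

/-- **The truncated zeta integral is `Z` against the restricted measure**:
`∫ F_s^<(g) ⟪φ', R(g) φ⟫ dν(g) = Z(Φ, s, φ, φ')` computed with `ν|_{|det| < 1}`
(`gjZeta μ (ν.restrict (detAtLeastOne n K)ᶜ)`, the second summand of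
`gjZeta_eq_restrict_add_restrict_compl`). [folklore] -/
theorem integral_gjTruncF_mul_glMatrixCoeff (Φ : Matrix (Fin n) (Fin n) (AdeleRing (𝓞 K) K) → ℂ)
    (φ φ' : (AdelicGroupData.gl n K).L2 μ) (s : ℂ) (ν : Measure (AdelicGroupData.gl n K).Adelic) :
    ∫ g : GL (Fin n) (AdeleRing (𝓞 K) K), gjTruncF n K Φ s g * glMatrixCoeff μ φ φ' g ∂ν =
      gjZeta μ (ν.restrict (detAtLeastOne n K)ᶜ) Φ φ φ' s := by
  have h1 : ∫ g : GL (Fin n) (AdeleRing (𝓞 K) K), gjTruncF n K Φ s g * glMatrixCoeff μ φ φ' g ∂ν =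
      ∫ g : GL (Fin n) (AdeleRing (𝓞 K) K), (detAtLeastOne n K)ᶜ.indicator (gjZetaIntegrand μ Φ φ φ' s) g ∂ν :=
    integral_congr_ae (Eventually.of_forall fun g => gjTruncF_mul_glMatrixCoeff_eq_indicator μ Φ φ φ' s g)
  rw [h1]
  exact integral_indicator (measurableSet_detAtLeastOne (n := n) (K := K)).compl

/-- **The matrix coefficient as an integral over the automorphic quotient**:
`⟪φ', R(g) φ⟫ = ∫_X conj(φ'(x)) φ(g⁻¹ • x) dμ(x)` (Mathlib's `L²` inner product and the a.e. formula
`(R(g) φ)(x) = φ(g⁻¹ • x)`, `rightRegular_apply_coeFn`). [folklore] -/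
theorem glMatrixCoeff_eq_integral (φ φ' : (AdelicGroupData.gl n K).L2 μ) (g : (AdelicGroupData.gl n K).Adelic) :
    glMatrixCoeff μ φ φ' g =
      ∫ x : (AdelicGroupData.gl n K).Adelic ⧸ (AdelicGroupData.gl n K).quotientSubgroup,
        conj ((φ' : (AdelicGroupData.gl n K).automorphicQuotient → ℂ) x) *
          (φ : (AdelicGroupData.gl n K).automorphicQuotient → ℂ) (g⁻¹ • x) ∂μ := by
  rw [glMatrixCoeff_apply, MeasureTheory.L2.inner_def]
  refine integral_congr_ae ?_
  filter_upwards [(AdelicGroupData.gl n K).rightRegular_apply_coeFn μ g φ] with x hx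
  rw [hx, RCLike.inner_apply']
  rfl

end Truncated

/-! ### Fibre integrability of a lifted `L¹` function (Weil's formula, `ℝ≥0∞` version) -/

section Fiber

variable {G : Type*} [Group G] [TopologicalSpace G] [IsTopologicalGroup G] [LocallyCompactSpace G]
  [SecondCountableTopology G] [T2Space G] [MeasurableSpace G] [BorelSpace G]
  (H : Subgroup G) [hH : IsClosed (H : Set G)]
  (ρ : Measure H) [ρ.IsMulLeftInvariant] [SFinite ρ] [IsFiniteMeasureOnCompacts ρ]
  [MeasurableSpace (G ⧸ H)] [BorelSpace (G ⧸ H)]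
  (μ : Measure (G ⧸ H)) [SMulInvariantMeasure G (G ⧸ H) μ] [IsFiniteMeasureOnCompacts μ]
  (ν : Measure G) [IsHaarMeasure ν] [ν.IsInvInvariant]
  {E : Type*} [NormedAddCommGroup E]

/-- **The two-sided lift `h ↦ F(x̃ h⁻¹ ỹ⁻¹)` of an integrable strongly measurable `F` is
`ρ`-integrable on `H` for `μ`-a.e. `ỹH`** (and every lift `ỹ`), for each fixed `x̃`: by Weil's
formula `∫_{G ⧸ H} ∫_H |F(x̃ (ỹ h)⁻¹)| dρ(h) dμ = c ∫_G |F(x̃ g⁻¹)| dν(g) = c ‖F‖₁ < ∞`. These are the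
fibres on which the kernel `K_F(x̃, ·)` of `AutomorphicQuotientKernel` is a genuine integral.
[folklore] -/
theorem ae_integrable_comp_mul_inv_mul_inv {F : G → E} (hF : Integrable F ν) (hFm : StronglyMeasurable F)
    (x₀ : G) :
    ∀ᵐ y ∂μ, ∀ y₀ : G, QuotientGroup.mk y₀ = y →
      Integrable (fun h : H => F (x₀ * ((h : G))⁻¹ * y₀⁻¹)) ρ := by
  set f : G → ℝ≥0∞ := fun g => ‖F (x₀ * g⁻¹)‖ₑ with hf
  have hfm : Measurable f := hFm.enorm.comp ((measurable_const_mul x₀).comp measurable_inv)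
  have hmp : MeasurePreserving (fun g : G => x₀ * g⁻¹) ν ν :=
    (measurePreserving_mul_left ν x₀).comp (Measure.measurePreserving_inv ν)
  have hfin : ∫⁻ x, fiberLIntegral H ρ f x ∂μ < ∞ := by
    rw [lintegral_fiberLIntegral_eq_mul_lintegral H ρ μ ν hfm]
    refine ENNReal.mul_lt_top ENNReal.coe_lt_top ?_
    have h1 : ∫⁻ g, f g ∂ν = ∫⁻ g, ‖F g‖ₑ ∂ν := hmp.lintegral_comp hFm.enorm
    rw [h1]
    exact hF.2
  have hae : ∀ᵐ x ∂μ, fiberLIntegral H ρ f x < ∞ :=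
    ae_lt_top (measurable_fiberLIntegral H ρ hfm) hfin.ne
  filter_upwards [hae] with y hy y₀ hy₀
  refine ⟨?_, ?_⟩
  · refine (hFm.comp_measurable ?_).aestronglyMeasurable
    exact ((measurable_const_mul x₀).comp (measurable_subtype_coe.inv)).mul_const _
  · change ∫⁻ h : H, ‖F (x₀ * ((h : G))⁻¹ * y₀⁻¹)‖ₑ ∂ρ < ∞
    rw [← hy₀, fiberLIntegral_mk] at hy
    refine lt_of_eq_of_lt (lintegral_congr fun h => ?_) hy
    simp only [hf, mul_inv_rev, mul_assoc]

end Fiber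

/-! ### Unfolding `Z^{<1}` over the automorphic quotient -/

section Unfold

variable {n : ℕ} {K : Type} [Field K] [NumberField K]

attribute [local instance] adelicBorel borelSpace_adelic locallyCompactSpace_adelic
  secondCountableTopology_gl_adelic measurableSpaceQuotient borelSpaceQuotient glBorel borelSpace_glBorel
  isHaarMeasure_glForm

variable (μ : Measure (AdelicGroupData.gl n K).automorphicQuotient)
  [(AdelicGroupData.gl n K).IsAutomorphicMeasure μ]
  (ν : Measure (AdelicGroupData.gl n K).Adelic) [ν.IsHaarMeasure]

attribute [local instance] smulInvariantMeasureQuotient isFiniteMeasureOnCompactsQuotient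

/-- **Unfolding of the truncated zeta integral over the automorphic quotient** (Godement–Jacquet
(1972), §12, first step of the proof of Thm. 13.8): for `Φ ∈ 𝒮(M_n(𝔸_K))`, `φ, φ' ∈ L²(X)`,
`X = GL_n(𝔸_K) ⧸ A_G GL_n(K)`, an automorphic measure `μ`, a Haar measure `ν` and `Re s ≥ n² + n + 2`,
`Z^{<1}(Φ, s, φ, φ') = c⁻¹ ∫_X conj(φ'(x)) (∫_X K_{F_s^<}(x̃, y) φ(y) dμ(y)) dμ(x)`,
with `F_s^< = gjTruncF`, `K` the kernel `cosetKernel` for the Haar measure `ρ_H = quotientSubgroupHaar`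
of `H = A_G · GL_n(K)`, `x̃ = Quotient.out x` and `c = automorphicUnfoldingConstant n K μ ν`
(`AutomorphicKernelL1.integral_mul_integral_mul_comp_smul_eq_inv_mul_integral_cosetKernel` applied to
`F_s^< ∈ L¹(GL_n(𝔸_K))`, `GL_n(𝔸_K)` being unimodular). [cite: GodementJacquet1972, §12] -/
theorem gjZeta_restrict_compl_eq_inv_mul_integral_cosetKernel
    {Φ : Matrix (Fin n) (Fin n) (AdeleRing (𝓞 K) K) → ℂ} (hΦ : Φ ∈ schwartzBruhatAdelicMatrix n K)
    (φ φ' : (AdelicGroupData.gl n K).L2 μ) {s : ℂ} (hs : (n : ℝ) * n + n + 2 ≤ s.re) :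
    gjZeta μ (ν.restrict (detAtLeastOne n K)ᶜ) Φ φ φ' s =
      ((((unfoldingConstant (AdelicGroupData.gl n K).quotientSubgroup (quotientSubgroupHaar n K) μ ν : ℝ≥0) : ℝ) : ℂ))⁻¹ *
        ∫ x : (AdelicGroupData.gl n K).Adelic ⧸ (AdelicGroupData.gl n K).quotientSubgroup,
          conj ((φ' : (AdelicGroupData.gl n K).automorphicQuotient → ℂ) x) *
          (∫ y : (AdelicGroupData.gl n K).Adelic ⧸ (AdelicGroupData.gl n K).quotientSubgroup,
              cosetKernel (AdelicGroupData.gl n K).quotientSubgroup (quotientSubgroupHaar n K)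
                (gjTruncF n K Φ s) (Quotient.out x) y *
            (φ : (AdelicGroupData.gl n K).automorphicQuotient → ℂ) y ∂μ) ∂μ := by
  haveI : ν.IsInvInvariant := isInvInvariant_of_isHaarMeasure_gl n K ν
  rw [← integral_gjTruncF_mul_glMatrixCoeff μ Φ φ φ' s ν]
  simp_rw [glMatrixCoeff_eq_integral μ φ φ']
  have hc : unfoldingConstant (AdelicGroupData.gl n K).quotientSubgroup (quotientSubgroupHaar n K) μ ν ≠ 0 :=
    (automorphicUnfoldingConstant_pos n K μ ν).ne'
  exact integral_mul_integral_mul_comp_smul_eq_inv_mul_integral_cosetKernel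
    (AdelicGroupData.gl n K).quotientSubgroup (quotientSubgroupHaar n K) μ ν hc
    (integrable_gjTruncF hΦ hs ν) (Lp.stronglyMeasurable φ) (Lp.memLp φ)
    ((Lp.memLp φ).integrable one_le_two)
    (Complex.continuous_conj.comp_stronglyMeasurable (Lp.stronglyMeasurable φ')) (memLp_two_conj (Lp.memLp φ'))

/-- **The fibres of the truncated test function are integrable**: for `Re s ≥ n² + n + 2`, every
`x̃ ∈ GL_n(𝔸_K)` and `μ`-a.e. `y` (every lift `ỹ`), `h ↦ F_s^<(x̃ h⁻¹ ỹ⁻¹)` is `ρ_H`-integrable on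
`H = A_G · GL_n(K)` — so that `K_{F_s^<}(x̃, y) = κ ∫_{A_G} Σ_γ F_s^<(x̃ γ a ỹ⁻¹) dα`
(`cosetKernel_quotientSubgroup_eq_smul_integral_tsum`) on these fibres. [folklore] -/
theorem ae_integrable_gjTruncF_fiber
    {Φ : Matrix (Fin n) (Fin n) (AdeleRing (𝓞 K) K) → ℂ} (hΦ : Φ ∈ schwartzBruhatAdelicMatrix n K)
    {s : ℂ} (hs : (n : ℝ) * n + n + 2 ≤ s.re) (x₀ : (AdelicGroupData.gl n K).Adelic) :
    ∀ᵐ y ∂μ, ∀ y₀ : (AdelicGroupData.gl n K).Adelic, (AdelicGroupData.gl n K).toAutomorphicQuotient y₀ = y →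
      Integrable (fun h : (AdelicGroupData.gl n K).quotientSubgroup =>
        gjTruncF n K Φ s (x₀ * ((h : (AdelicGroupData.gl n K).Adelic))⁻¹ * y₀⁻¹)) (quotientSubgroupHaar n K) := by
  haveI : (Measure.haar : Measure (AdelicGroupData.gl n K).Adelic).IsInvInvariant :=
    isInvInvariant_of_isHaarMeasure_gl n K _
  have hFm : StronglyMeasurable (gjTruncF n K Φ s) := by
    have hc : Continuous fun g : GL (Fin n) (AdeleRing (𝓞 K) K) =>
        Φ (g : Matrix (Fin n) (Fin n) (AdeleRing (𝓞 K) K)) * ((adelicAbsDet n K g : ℝ) : ℂ) ^ s :=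
      ((continuous_of_mem_schwartzBruhatAdelicMatrix hΦ).comp Units.continuous_val).mul
        (continuous_adelicAbsDet_cpow s)
    exact hc.stronglyMeasurable.indicator (measurableSet_detAtLeastOne (n := n) (K := K)).compl
  exact ae_integrable_comp_mul_inv_mul_inv (AdelicGroupData.gl n K).quotientSubgroup
    (quotientSubgroupHaar n K) μ (Measure.haar : Measure (AdelicGroupData.gl n K).Adelic)
    (integrable_gjTruncF hΦ hs _) hFm x₀

end Unfold

end Literature.NumberTheory.Automorphic
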